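import Mathlib
import HarnessLib
import Summits.KontsevichZagierPeriods.Zeta5Search.BarnesKernelBounds
import Literature.Analysis.Complex.ConeTubeIdentity

/-!
# ζ(5) search — Nesterenko's Barnes integral continued off the negative axis (cell `pub-zeta5`, ct-1 g27)

HONEST FRAMING: systematic search; no irrationality claim unless kernel-certified.  An identity of special functions
(analytic continuation of a Mellin–Barnes representation); nothing here is an irrationality result, a worthiness exponent
or a denominator statement; no named fact is discharged.

Second third of brick B2-on-the-cut of `HOME/ct-1/g26/VWP-BLUEPRINT.md` (for `Zudilin2002.vwp_eq_integral_of_pos`).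
ct-1 g26 proved Zudilin's Lemma 2 (math/0206177) for a NEGATIVE real argument `z = −ζ`:

  `eulerIntegral a₀ a b (−ζ) = Γ(b−a)/Γ(a₀) · (1/2π) ∫_ℝ K(y) ζ^{s} dy`,  `K(y) = Γ(a₀+s)Γ(a+s)Γ(−s)/Γ(b+s)`, `s = −t₀+iy`.

Here the identity is continued in the variable `w = −z` to the whole domain

  `U = slitPlane ∩ {Re w > −1}`

(open, star-convex at `1`): both sides are holomorphic in `w` on `U` —

* `hasDerivAt_barnes` / `differentiableOn_barnes`: `w ↦ ∫_ℝ K(y) w^{s} dy` is complex-differentiable on Mathlib's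
  `Complex.slitPlane` (differentiation under the integral sign; on a closed ball inside the slit plane `|arg w| ≤ θ < π` and
  `‖w‖ ≥ m > 0` (`exists_ball_bounds`), so `‖K(y)·s·w^{s−1}‖ ≤ ‖K(y)‖(t₀+|y|)m^{−t₀−1}e^{θ|y|}`, integrable by
  `BarnesKernelBounds.integrable_kernel_mul_exp`);
* `differentiableOn_euler_neg`: `w ↦ eulerIntegral a₀ a b (−w)` is complex-differentiable on `{Re w > −1}`
  (`Literature…Hypergeometric.hasDerivAt_eulerIntegral` on the half-plane `Re z < 1`);

and they agree at every real point `w = ζ > 0` of `U` (the landed theorem), hence on `U`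
(`Literature.Analysis.Complex.eqOn_of_isPreconnected_of_eq_ofReal`): `eulerIntegral_neg_eq_barnes_of_mem`.  The values ON
the cut `w ∈ [−1, 0)` (i.e. `0 < z ≤ 1`) are boundary values of this identity and are taken in the sequel file.
Theorems only (no definitions); imports `Zeta5Search/BarnesKernelBounds`, `Literature.Analysis.Complex.ConeTubeIdentity`.
-/

noncomputable section

namespace Summit.KontsevichZagierPeriods.Zeta5Search.BarnesEulerContinuation

open MeasureTheory Set Filter Metric
open scoped Real Topology
open Literature.Analysis.SpecialFunctions.Hypergeometric (eulerIntegral hasDerivAt_eulerIntegral)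
open Summit.KontsevichZagierPeriods.Zeta5Search.BarnesKernelBounds

variable {t₀ : ℝ} {a₀ a b : ℂ}

/-! ### 1. Geometry of the slit plane: uniform bounds on small closed balls -/

/-- Around every point of the slit plane there is a closed ball inside the slit plane on which `|arg w| ≤ θ` for some
`θ < π` and `‖w‖ ≥ m` for some `m > 0` (compactness and continuity of `arg`, `‖·‖` on the slit plane). -/
theorem exists_ball_bounds {w₀ : ℂ} (hw₀ : w₀ ∈ Complex.slitPlane) :
    ∃ ρ : ℝ, 0 < ρ ∧ closedBall w₀ ρ ⊆ Complex.slitPlane ∧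
      ∃ θ : ℝ, θ < π ∧ ∃ m : ℝ, 0 < m ∧ ∀ w ∈ closedBall w₀ ρ, |Complex.arg w| ≤ θ ∧ m ≤ ‖w‖ := by
  obtain ⟨ε, hε, hball⟩ := Metric.isOpen_iff.1 Complex.isOpen_slitPlane w₀ hw₀
  have hsub : closedBall w₀ (ε / 2) ⊆ Complex.slitPlane :=
    (closedBall_subset_ball (by linarith)).trans hball
  have hK : IsCompact (closedBall w₀ (ε / 2)) := isCompact_closedBall _ _
  have hne : (closedBall w₀ (ε / 2)).Nonempty := ⟨w₀, mem_closedBall_self (by linarith)⟩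
  -- maximum of |arg|
  have harg : ContinuousOn (fun w : ℂ => |Complex.arg w|) (closedBall w₀ (ε / 2)) := fun w hw =>
    ((Complex.continuousAt_arg (hsub hw)).abs).continuousWithinAt
  obtain ⟨w₁, hw₁, hmax⟩ := hK.exists_isMaxOn hne harg
  -- minimum of the norm
  obtain ⟨w₂, hw₂, hmin⟩ := hK.exists_isMinOn hne (continuous_norm.continuousOn)
  have hθ : |Complex.arg w₁| < π := by
    have h1 := Complex.mem_slitPlane_iff_arg.1 (hsub hw₁)
    exact abs_lt.2 ⟨Complex.neg_pi_lt_arg _, lt_of_le_of_ne (Complex.arg_le_pi _) h1.1⟩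
  have hm : 0 < ‖w₂‖ := norm_pos_iff.2 (Complex.slitPlane_ne_zero (hsub hw₂))
  exact ⟨ε / 2, by linarith, hsub, |Complex.arg w₁|, hθ, ‖w₂‖, hm, fun w hw => ⟨hmax hw, hmin hw⟩⟩

/-- Norm of `w^{s}` on the line `s = −t₀ + iy` (`t₀ ≥ 0`): if `‖w‖ ≥ m > 0` and `|arg w| ≤ θ` then
`‖w^{−t₀+iy}‖ ≤ m^{−t₀} e^{θ|y|}` (`‖w^{s}‖ = ‖w‖^{Re s} e^{−arg w · Im s}`). -/
theorem norm_cpow_line_le {w : ℂ} {m θ : ℝ} (hm : 0 < m) (hmw : m ≤ ‖w‖) (hθ : |Complex.arg w| ≤ θ) (ht₀ : 0 ≤ t₀)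
    (y : ℝ) : ‖w ^ (-(t₀ : ℂ) + (y : ℂ) * Complex.I)‖ ≤ m ^ (-t₀) * Real.exp (θ * |y|) := by
  have hw : w ≠ 0 := norm_pos_iff.1 (lt_of_lt_of_le hm hmw)
  rw [Complex.norm_cpow_of_ne_zero hw]
  have hre : (-(t₀ : ℂ) + (y : ℂ) * Complex.I).re = -t₀ := by simp
  have him : (-(t₀ : ℂ) + (y : ℂ) * Complex.I).im = y := by simp
  rw [hre, him, div_eq_mul_inv, ← Real.exp_neg]
  have h1 : ‖w‖ ^ (-t₀) ≤ m ^ (-t₀) := Real.rpow_le_rpow_of_nonpos hm hmw (by linarith)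
  have h2 : Real.exp (-(Complex.arg w * y)) ≤ Real.exp (θ * |y|) := by
    apply Real.exp_le_exp.2
    calc -(Complex.arg w * y) ≤ |Complex.arg w * y| := neg_le_abs _
      _ = |Complex.arg w| * |y| := abs_mul _ _
      _ ≤ θ * |y| := mul_le_mul_of_nonneg_right hθ (abs_nonneg _)
  exact mul_le_mul h1 h2 (Real.exp_pos _).le (Real.rpow_nonneg hm.le _)

/-- The shifted exponent: `s − 1 = −(t₀+1) + iy`. -/
theorem line_sub_one (t₀ y : ℝ) :
    (-(t₀ : ℂ) + (y : ℂ) * Complex.I) - 1 = -((t₀ + 1 : ℝ) : ℂ) + (y : ℂ) * Complex.I := by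
  push_cast; ring

/-- `‖s‖ ≤ t₀ + |y|` for `s = −t₀ + iy`, `t₀ ≥ 0`. -/
theorem norm_line_le (ht₀ : 0 ≤ t₀) (y : ℝ) : ‖(-(t₀ : ℂ) + (y : ℂ) * Complex.I)‖ ≤ t₀ + |y| := by
  calc ‖(-(t₀ : ℂ) + (y : ℂ) * Complex.I)‖ ≤ ‖-(t₀ : ℂ)‖ + ‖(y : ℂ) * Complex.I‖ := norm_add_le _ _
    _ = t₀ + |y| := by
        rw [norm_neg, Complex.norm_real, norm_mul, Complex.norm_I, mul_one, Complex.norm_real,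
          Real.norm_eq_abs, Real.norm_eq_abs, abs_of_nonneg ht₀]

/-! ### 2. Holomorphy of the Barnes side on the slit plane -/

/-- For `w ≠ 0` the integrand `y ↦ K(y) w^{s}` is continuous, hence a.e.-strongly measurable. -/
theorem continuous_integrand (ht₀ : 0 < t₀) (ht₀' : t₀ < a₀.re) (hta : t₀ < a.re) (htb : t₀ < b.re) {w : ℂ}
    (hw : w ≠ 0) :
    Continuous fun y : ℝ =>
      Complex.Gamma (a₀ + (-(t₀ : ℂ) + (y : ℂ) * Complex.I)) * Complex.Gamma (a + (-(t₀ : ℂ) + (y : ℂ) * Complex.I)) *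
            Complex.Gamma (-(-(t₀ : ℂ) + (y : ℂ) * Complex.I)) /
          Complex.Gamma (b + (-(t₀ : ℂ) + (y : ℂ) * Complex.I)) *
        w ^ (-(t₀ : ℂ) + (y : ℂ) * Complex.I) :=
  (continuous_kernel ht₀ ht₀' hta htb).mul ((by fun_prop : Continuous fun y : ℝ => -(t₀ : ℂ) + (y : ℂ) * Complex.I).const_cpow
    (Or.inl hw))

/-- **Differentiation under the integral sign**: at every point `w₀` of the slit plane,
`d/dw ∫_ℝ K(y) w^{s} dy = ∫_ℝ K(y) s w₀^{s−1} dy` (`0 < t₀ < Re a₀`, `t₀ < Re a`, `t₀ < Re b`). -/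
theorem hasDerivAt_barnes (ht₀ : 0 < t₀) (ht₀' : t₀ < a₀.re) (hta : t₀ < a.re) (htb : t₀ < b.re) {w₀ : ℂ}
    (hw₀ : w₀ ∈ Complex.slitPlane) :
    HasDerivAt (fun w : ℂ => ∫ y : ℝ,
        Complex.Gamma (a₀ + (-(t₀ : ℂ) + (y : ℂ) * Complex.I)) * Complex.Gamma (a + (-(t₀ : ℂ) + (y : ℂ) * Complex.I)) *
              Complex.Gamma (-(-(t₀ : ℂ) + (y : ℂ) * Complex.I)) /
            Complex.Gamma (b + (-(t₀ : ℂ) + (y : ℂ) * Complex.I)) *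
          w ^ (-(t₀ : ℂ) + (y : ℂ) * Complex.I))
      (∫ y : ℝ,
        Complex.Gamma (a₀ + (-(t₀ : ℂ) + (y : ℂ) * Complex.I)) * Complex.Gamma (a + (-(t₀ : ℂ) + (y : ℂ) * Complex.I)) *
              Complex.Gamma (-(-(t₀ : ℂ) + (y : ℂ) * Complex.I)) /
            Complex.Gamma (b + (-(t₀ : ℂ) + (y : ℂ) * Complex.I)) *
          ((-(t₀ : ℂ) + (y : ℂ) * Complex.I) * w₀ ^ ((-(t₀ : ℂ) + (y : ℂ) * Complex.I) - 1))) w₀ := by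
  obtain ⟨ρ, hρ, hsub, θ, hθ, m, hm, hbd⟩ := exists_ball_bounds hw₀
  -- names for kernel, integrand and derivative
  set K : ℝ → ℂ := fun y =>
    Complex.Gamma (a₀ + (-(t₀ : ℂ) + (y : ℂ) * Complex.I)) * Complex.Gamma (a + (-(t₀ : ℂ) + (y : ℂ) * Complex.I)) *
        Complex.Gamma (-(-(t₀ : ℂ) + (y : ℂ) * Complex.I)) /
      Complex.Gamma (b + (-(t₀ : ℂ) + (y : ℂ) * Complex.I)) with hK
  set F : ℂ → ℝ → ℂ := fun w y => K y * w ^ (-(t₀ : ℂ) + (y : ℂ) * Complex.I) with hF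
  set F' : ℂ → ℝ → ℂ := fun w y =>
    K y * ((-(t₀ : ℂ) + (y : ℂ) * Complex.I) * w ^ ((-(t₀ : ℂ) + (y : ℂ) * Complex.I) - 1)) with hF'
  -- the majorant
  set M : ℝ := (t₀ + 1) * m ^ (-(t₀ + 1)) with hM
  have hM0 : 0 < M := by positivity
  set bound : ℝ → ℝ := fun y => ‖K y * ((((1 + |y|) * (M * Real.exp (θ * |y|)) : ℝ) : ℂ))‖ with hbound
  have hbound_int : Integrable bound := (integrable_kernel_mul_exp ht₀ ht₀' hta htb hθ M).norm
  -- measurability of `F w` near `w₀`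
  have hF_meas : ∀ᶠ w in 𝓝 w₀, AEStronglyMeasurable (F w) volume := by
    filter_upwards [Complex.isOpen_slitPlane.mem_nhds hw₀] with w hw
    exact (continuous_integrand ht₀ ht₀' hta htb (Complex.slitPlane_ne_zero hw)).aestronglyMeasurable
  -- integrability of `F w₀`
  have hw₀0 : w₀ ≠ 0 := Complex.slitPlane_ne_zero hw₀
  have hbd₀ := hbd w₀ (mem_closedBall_self hρ.le)
  have hF_int : Integrable (F w₀) := by
    refine (integrable_kernel_mul_exp ht₀ ht₀' hta htb hθ (m ^ (-t₀))).norm.mono'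
      (continuous_integrand ht₀ ht₀' hta htb hw₀0).aestronglyMeasurable (Eventually.of_forall fun y => ?_)
    have hw := norm_cpow_line_le hm hbd₀.2 hbd₀.1 ht₀.le y
    have hreal : ‖((((1 + |y|) * (m ^ (-t₀) * Real.exp (θ * |y|)) : ℝ) : ℂ))‖ =
        (1 + |y|) * (m ^ (-t₀) * Real.exp (θ * |y|)) := by
      rw [Complex.norm_real, Real.norm_eq_abs, abs_of_nonneg (by positivity)]
    rw [hF]
    simp only
    rw [norm_mul, norm_mul, hreal]
    refine mul_le_mul_of_nonneg_left ?_ (norm_nonneg _)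
    calc ‖w₀ ^ (-(t₀ : ℂ) + (y : ℂ) * Complex.I)‖ ≤ m ^ (-t₀) * Real.exp (θ * |y|) := hw
      _ = 1 * (m ^ (-t₀) * Real.exp (θ * |y|)) := (one_mul _).symm
      _ ≤ (1 + |y|) * (m ^ (-t₀) * Real.exp (θ * |y|)) := by gcongr; linarith [abs_nonneg y]
  -- measurability of `F' w₀`
  have hF'_meas : AEStronglyMeasurable (F' w₀) volume := by
    refine ((continuous_kernel ht₀ ht₀' hta htb).mul (Continuous.mul (by fun_prop) ?_)).aestronglyMeasurable
    exact (by fun_prop : Continuous fun y : ℝ => (-(t₀ : ℂ) + (y : ℂ) * Complex.I) - 1).const_cpow (Or.inl hw₀0)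
  -- the bound on the ball
  have h_bound : ∀ᵐ y ∂volume, ∀ w ∈ closedBall w₀ ρ, ‖F' w y‖ ≤ bound y := by
    refine Eventually.of_forall fun y w hw => ?_
    obtain ⟨hargw, hmw⟩ := hbd w hw
    have hcp : ‖w ^ ((-(t₀ : ℂ) + (y : ℂ) * Complex.I) - 1)‖ ≤ m ^ (-(t₀ + 1)) * Real.exp (θ * |y|) := by
      rw [line_sub_one]
      exact norm_cpow_line_le hm hmw hargw (by linarith) y
    have hs := norm_line_le ht₀.le y
    have hreal : ‖((((1 + |y|) * (M * Real.exp (θ * |y|)) : ℝ) : ℂ))‖ = (1 + |y|) * (M * Real.exp (θ * |y|)) := by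
      rw [Complex.norm_real, Real.norm_eq_abs, abs_of_nonneg (by positivity)]
    rw [hbound, hF']
    simp only
    rw [norm_mul, norm_mul, norm_mul, hreal]
    refine mul_le_mul_of_nonneg_left ?_ (norm_nonneg _)
    calc ‖(-(t₀ : ℂ) + (y : ℂ) * Complex.I)‖ * ‖w ^ ((-(t₀ : ℂ) + (y : ℂ) * Complex.I) - 1)‖
        ≤ (t₀ + |y|) * (m ^ (-(t₀ + 1)) * Real.exp (θ * |y|)) := mul_le_mul hs hcp (norm_nonneg _) (by positivity)
      _ ≤ ((t₀ + 1) * (1 + |y|)) * (m ^ (-(t₀ + 1)) * Real.exp (θ * |y|)) := by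
          gcongr; nlinarith [abs_nonneg y, ht₀.le]
      _ = (1 + |y|) * (M * Real.exp (θ * |y|)) := by rw [hM]; ring
  -- differentiability of the integrand in `w`
  have h_diff : ∀ᵐ y ∂volume, ∀ w ∈ closedBall w₀ ρ, HasDerivAt (fun w => F w y) (F' w y) w := by
    refine Eventually.of_forall fun y w hw => ?_
    have h := ((hasDerivAt_id w).cpow_const (c := -(t₀ : ℂ) + (y : ℂ) * Complex.I) (hsub hw)).const_mul (K y)
    rw [hF, hF']
    simpa using h
  exact (hasDerivAt_integral_of_dominated_loc_of_deriv_le (closedBall_mem_nhds w₀ hρ) hF_meas hF_int hF'_meas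
    h_bound hbound_int h_diff).2

/-- **Holomorphy of the Barnes side**: `w ↦ ∫_ℝ K(y) w^{s} dy` is complex-differentiable on the slit plane. -/
theorem differentiableOn_barnes (ht₀ : 0 < t₀) (ht₀' : t₀ < a₀.re) (hta : t₀ < a.re) (htb : t₀ < b.re) :
    DifferentiableOn ℂ (fun w : ℂ => ∫ y : ℝ,
        Complex.Gamma (a₀ + (-(t₀ : ℂ) + (y : ℂ) * Complex.I)) * Complex.Gamma (a + (-(t₀ : ℂ) + (y : ℂ) * Complex.I)) *
              Complex.Gamma (-(-(t₀ : ℂ) + (y : ℂ) * Complex.I)) /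
            Complex.Gamma (b + (-(t₀ : ℂ) + (y : ℂ) * Complex.I)) *
          w ^ (-(t₀ : ℂ) + (y : ℂ) * Complex.I)) Complex.slitPlane := fun _ hw =>
  (hasDerivAt_barnes ht₀ ht₀' hta htb hw).differentiableAt.differentiableWithinAt

/-! ### 3. Holomorphy of the Euler side and the continuation domain -/

/-- **Holomorphy of the Euler side** in `w = −z`: `w ↦ eulerIntegral a₀ a b (−w)` is complex-differentiable on
`{Re w > −1}` (the half-plane `Re z < 1` of `Hypergeometric.hasDerivAt_eulerIntegral`; needs `0 < Re a < Re b`). -/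
theorem differentiableOn_euler_neg (a₀ : ℂ) (ha : 0 < a.re) (hab : a.re < b.re) :
    DifferentiableOn ℂ (fun w : ℂ => eulerIntegral a₀ a b (-w)) {w : ℂ | -1 < w.re} := by
  intro w hw
  have hz : (-w).re < 1 := by simp at hw ⊢; linarith
  exact ((hasDerivAt_eulerIntegral a₀ ha hab hz).differentiableAt.comp w differentiable_neg.differentiableAt)
    |>.differentiableWithinAt

/-- The continuation domain `U = slitPlane ∩ {Re w > −1}` is open. -/
theorem isOpen_domain : IsOpen (Complex.slitPlane ∩ {w : ℂ | -1 < w.re}) :=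
  Complex.isOpen_slitPlane.inter (isOpen_lt continuous_const Complex.continuous_re)

/-- The continuation domain `U = slitPlane ∩ {Re w > −1}` is star-convex at `1`, hence preconnected. -/
theorem isPreconnected_domain : IsPreconnected (Complex.slitPlane ∩ {w : ℂ | -1 < w.re}) := by
  have h1 : (1 : ℂ) ∈ Complex.slitPlane ∩ {w : ℂ | -1 < w.re} := ⟨Complex.one_mem_slitPlane, by simp⟩
  have hstar : StarConvex ℝ (1 : ℂ) (Complex.slitPlane ∩ {w : ℂ | -1 < w.re}) :=
    Complex.starConvex_one_slitPlane.inter ((convex_halfSpace_re_gt (-1)).starConvex h1.2)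
  exact (hstar.isPathConnected h1).isConnected.isPreconnected

/-! ### 4. The continued identity -/

/-- **Zudilin's Lemma 2 continued off the negative axis** [Zudilin math/0206177, Lemma 2; Nesterenko 2003, §3.2]:
for complex `a₀, a, b` and real `t₀` with `0 < t₀ < Re a₀`, `t₀ < Re a`, `Re a < Re b`, and every `w` in the slit plane
with `Re w > −1`,
`eulerIntegral a₀ a b (−w) = ∫₀¹ t^{a−1}(1−t)^{b−a−1}(1+wt)^{−a₀} dt = Γ(b−a)/Γ(a₀) · (1/2π) ∫_ℝ Γ(a₀+s)Γ(a+s)Γ(−s)/Γ(b+s)·w^{s} dy`,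
`s = −t₀+iy` (principal-branch `w^{s}`; both sides holomorphic on `U = slitPlane ∩ {Re w > −1}`, equal at its real points
`w = ζ > 0` by `BarnesEulerIntegral.eulerIntegral_neg_eq_barnes`, hence equal on `U` by the identity theorem). -/
theorem eulerIntegral_neg_eq_barnes_of_mem (ht₀ : 0 < t₀) (ht₀' : t₀ < a₀.re) (hta : t₀ < a.re) (hab : a.re < b.re)
    {w : ℂ} (hw : w ∈ Complex.slitPlane) (hw' : -1 < w.re) :
    eulerIntegral a₀ a b (-w) =
      Complex.Gamma (b - a) / Complex.Gamma a₀ *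
        ((1 / (2 * π) : ℂ) * ∫ y : ℝ,
          Complex.Gamma (a₀ + (-(t₀ : ℂ) + (y : ℂ) * Complex.I)) * Complex.Gamma (a + (-(t₀ : ℂ) + (y : ℂ) * Complex.I)) *
              Complex.Gamma (-(-(t₀ : ℂ) + (y : ℂ) * Complex.I)) /
              Complex.Gamma (b + (-(t₀ : ℂ) + (y : ℂ) * Complex.I)) *
            w ^ (-(t₀ : ℂ) + (y : ℂ) * Complex.I)) := by
  have ha : 0 < a.re := lt_trans ht₀ hta
  have htb : t₀ < b.re := lt_trans hta hab
  have hf : DifferentiableOn ℂ (fun w : ℂ => eulerIntegral a₀ a b (-w)) (Complex.slitPlane ∩ {w : ℂ | -1 < w.re}) :=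
    (differentiableOn_euler_neg a₀ ha hab).mono inter_subset_right
  have hg : DifferentiableOn ℂ (fun w : ℂ => Complex.Gamma (b - a) / Complex.Gamma a₀ *
        ((1 / (2 * π) : ℂ) * ∫ y : ℝ,
          Complex.Gamma (a₀ + (-(t₀ : ℂ) + (y : ℂ) * Complex.I)) * Complex.Gamma (a + (-(t₀ : ℂ) + (y : ℂ) * Complex.I)) *
              Complex.Gamma (-(-(t₀ : ℂ) + (y : ℂ) * Complex.I)) /
              Complex.Gamma (b + (-(t₀ : ℂ) + (y : ℂ) * Complex.I)) *
            w ^ (-(t₀ : ℂ) + (y : ℂ) * Complex.I)))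
      (Complex.slitPlane ∩ {w : ℂ | -1 < w.re}) :=
    (((differentiableOn_barnes ht₀ ht₀' hta htb).mono inter_subset_left).const_mul _).const_mul _
  have hreal : ∀ t : ℝ, (t : ℂ) ∈ Complex.slitPlane ∩ {w : ℂ | -1 < w.re} →
      eulerIntegral a₀ a b (-(t : ℂ)) =
        Complex.Gamma (b - a) / Complex.Gamma a₀ *
          ((1 / (2 * π) : ℂ) * ∫ y : ℝ,
            Complex.Gamma (a₀ + (-(t₀ : ℂ) + (y : ℂ) * Complex.I)) * Complex.Gamma (a + (-(t₀ : ℂ) + (y : ℂ) * Complex.I)) *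
                Complex.Gamma (-(-(t₀ : ℂ) + (y : ℂ) * Complex.I)) /
                Complex.Gamma (b + (-(t₀ : ℂ) + (y : ℂ) * Complex.I)) *
              (t : ℂ) ^ (-(t₀ : ℂ) + (y : ℂ) * Complex.I)) := by
    intro t ht
    exact BarnesEulerIntegral.eulerIntegral_neg_eq_barnes (Complex.ofReal_mem_slitPlane.1 ht.1) ht₀ ht₀' hta hab
  have h1 : ((1 : ℝ) : ℂ) ∈ Complex.slitPlane ∩ {w : ℂ | -1 < w.re} := by
    refine ⟨Complex.ofReal_mem_slitPlane.2 one_pos, ?_⟩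
    simp
  exact Literature.Analysis.Complex.eqOn_of_isPreconnected_of_eq_ofReal isOpen_domain isPreconnected_domain h1 hf hg
    hreal ⟨hw, hw'⟩

end Summit.KontsevichZagierPeriods.Zeta5Search.BarnesEulerContinuation

end
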